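/-
Copyright (c) 2026 the pub-hodgecm-mathlib formalisation cell (harness21).  Prover seat hodgecm-mathlib-K2Liu-p01 (g8), Track B «K2-LIT»,
#184♮ = hLiu418 = `stmt-HodgeConjecture-24832`; #42S organ S1 ROAD W, F7 `K2LiuLocalSWParityOscillation` ∕ F7r ∕ F8 (RULINGS «M-158a» (2), «M-158b»); organ lead
K2Liu-p06 (g4) SPEC-S1-AssemblySocket §2 row `hsum`; my CENSUS-F7-ProfileSumTransport (d5aeea8ad1f9d314) file (T3a) = K2Liu-p08 (g4)'s shared letter 11:57:43Z:
the PAIRING `⟪t, x⟫ = x ⬝ᵥ (c_{n(t)} x)` of ★ F4a's big-cell integrand, as a HERMITIAN GRAM expression, for every place at once.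
-/
import Literature.NumberTheory.GelbartRogawski1991.LocalDoubledSiegelUnipotentAnisotropy   -- ★ `dotProduct_cOfFix_mover_conj(_eq_im)`, `matA_mulVec_of_adapt`, `formD_dblV_adblV`
import Summits.HodgeConjecture.HodgeConjecture.Theorems.K2LiuLocalSWTensorAdaptedBlocks      -- ★ F5c-A `matA_tensorEmbLoc`, `blk_reindex_kronecker`, `gramS_tensor`
import Mathlib.LinearAlgebra.Matrix.Trace
import Mathlib.LinearAlgebra.Matrix.Kronecker
import HarnessLib

/-!
# Crux `HLiu418`, #42S-S1 ROAD W, file (T3a): THE SIEGEL-UNIPOTENT PAIRING IS A GRAM PAIRING —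
# `x ⬝ᵥ (c_{g} x) = im(2 · bᴴ 𝕋₀ (t b))`, `b = halfDiff(eD⁻¹ E′⁻¹ (x, 0))`, and in a Kronecker frame `bᴴ (S ⊗ D)((t ⊗ 1) b) = tr(S · t · G(b))`, `G = β D (σβ)ᵀ`

Cell `hodgecm-mathlib`, crux item hLiu418 = `stmt-HodgeConjecture-24832` (helper lane `--supports … --as helper`, count-neutral).  THEOREMS ONLY (no `def`, no instance,
no notation, no named-fact hypothesis, no `sorry`).  PLACE-GENERIC: over `LocalRing E v = Π_{w ∣ v} E_w` for ALL `w ∣ v` at once (no unramified ∕ non-split hypothesis), as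
K2Liu-p08 (g4) asked (F8 reads it at `(w₀, w̄₀)`, F7 at the inert `w`, F7r at the ramified `w`).

THE SITUATION.  ★ F4a `K2LiuLocalSWBigCellFormula.exists_ne_zero_swSectionLoc_weylDelta_mul_nElem_eq_integral` computes the big-cell profile of the local Siegel–Weil
section as `γ′ ∫ ψ_v(−½ · x ⬝ᵥ (c_t *ᵥ x)) (ΓΦ)(x) dμ` with the Rao parameter `c_t = cOfFix 𝕋 (E′ ι(n(t)) E′⁻¹)`; ★ (T1) `K2LiuProfileSumCharacterOrthogonality` needs the pairing
`t ↦ x ⬝ᵥ (c_t *ᵥ x)` to be ADDITIVE in `t`, and ★ (T3-core) `K2LiuLatticePairCellCount` needs it to be a GRAM PAIRING `tr(t · G(x))`-like so that «trivial on all `t` of a box»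
reads «`G(x)` in the dual box».  Both follow from ★ `dotProduct_cOfFix_mover_conj` (`x ⬝ᵥ c_g x = formD(u, matA g · u)`), ★ `matA_mulVec_of_adapt` and ★ `formD_dblV_adblV`:
* §1 (the doubled local currency of ★ `LocalDoubledSiegelUnipotentMover`, ANY mover `E′`, ANY adapted unipotent `g` with parameter `t`):
  **`dotProduct_cOfFix_mover_conj_eq_im_herm`** — `x ⬝ᵥ (c_g *ᵥ x) = im (2 · ((σ ∘ b) ⬝ᵥ (𝕋₀ *ᵥ (t *ᵥ b))))`, `b = halfDiff (eD⁻¹ (E′⁻¹ (x, 0)))`, `𝕋₀ = gramS T₀`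
  (★ `…_eq_im` is its case `t = τ • 1`); `…_nElem_eq_im_herm` for `g = n(t)` (★ `adapt_matA_nElem`); **`herm_pairing_add`** — additivity in `t`.
* §2 (pure matrix algebra, any commutative ring, any `σ : R → R`, Kronecker frame `e : ι × κ ≃ ι′`): **`dotProduct_reindex_kronecker_mulVec_eq_trace`** —
  `(σ ∘ b) ⬝ᵥ (reindex e e (S ⊗ₖ D) *ᵥ (reindex e e (t ⊗ₖ 1) *ᵥ b)) = trace (S * t * G)` with the GRAM MATRIX `G j i = Σ_{k l} b(e(j,l)) · D k l · σ(b(e(i,k)))`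
  (for diagonal `D = diag dV′`: `G j i = Σ_k dV′_k · b_{jk} · σ(b_{ik}) = h_{V′}(x_j, x_i)`, `gram_diagonal`) — the `V′`-Gram of the `Δ⁻`-component in ★ `tensorEmbLoc` coordinates
  (★ F5c-A `matA_tensorEmbLoc`: the parameter of `n(t) ⊗ 1` is `reindex epsV (t ⊗ₖ 1)`, ★ `gramS_tensor`: `𝕋₀′ = reindex epsV (𝕋₀ ⊗ₖ (diag dV′)_v)`).
[Kudla1994, §3] [HarrisKudlaSweet1996, §1 (1.11)] [Rangarao1993, Lemma 3.2 (3.8) p. 351] [Shimura1997, §13.2].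
HONEST LABEL.  Count-neutral helper; `HC_CM` is proved only modulo the 7 printed citations (2 remaining named inputs: hLiu418 = `stmt-HodgeConjecture-24832`,
h413 = `stmt-HodgeConjecture-24833`) until rung 0 closes.  NOT here: the composition with ★ `tensorEmbLoc` at the CM datum ((T3a-CM), after the organ's frame letters) and the
dual-box reading «`ψ_v(⟪t,x⟫) = 1 ∀ t ∈ 𝔰_Λ` ↔ `G(x) ∈ Λ^⊥`» ((T3-frame)).

## References
* [Kudla1994] S. S. Kudla, *Splitting metaplectic covers of dual reductive pairs*, Israel J. Math. 87 (1994), §3.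
* [HarrisKudlaSweet1996] M. Harris, S. S. Kudla, W. J. Sweet, J. Amer. Math. Soc. 9 (1996), §1 (1.11).
* [Rangarao1993] R. Ranga Rao, Pacific J. Math. 157 (1993), Lemma 3.2 (3.8), p. 351.
* [Shimura1997] G. Shimura, *Euler products and Eisenstein series*, CBMS 93 (1997), §13.2.
-/

set_option autoImplicit false
set_option linter.dupNamespace false -- the mandated namespace repeats `HodgeConjecture.HodgeConjecture`

noncomputable section

open NumberField IsDedekindDomain Matrix
open Literature.RepresentationTheory.HeisenbergGroup Literature.RepresentationTheory.HeisenbergGroup.SymplecticMatrix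
open Literature.NumberTheory.Automorphic Literature.NumberTheory.Automorphic.UnitaryGroup Literature.NumberTheory.Weil1964
open Literature.NumberTheory.Automorphic.UnitaryGroup.QuadraticCoordinates
open Literature.NumberTheory.GelbartRogawski1991.AdaptedBlocks
open Literature.NumberTheory.GelbartRogawski1991 Literature.NumberTheory.GelbartRogawski1991.GRConstruction
open Literature.NumberTheory.GelbartRogawski1991.UnitaryDualPair Literature.NumberTheory.GelbartRogawski1991.UnitaryDualPair.LocalSplitting
open Literature.NumberTheory.K2Lit.SiegelDoubled
open Summit.HodgeConjecture.HodgeConjecture.Cruxes.HLiu418.K2LiuLocalSWSectionDefs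
open Summit.HodgeConjecture.HodgeConjecture.Cruxes.HLiu418.K2LiuLocalSWTensorAdaptedBlocks
open scoped Kronecker

namespace Summit.HodgeConjecture.HodgeConjecture.Cruxes.HLiu418.K2LiuSiegelUnipotentPairingGram

/-! ## §1 The pairing of an adapted unipotent is the doubled hermitian form on the `Δ⁻`-component -/

section Doubled

variable (F : Type) [Field F] [NumberField F] (E : Type) [Field E] [NumberField E] [Algebra F E]
  [Algebra.IsQuadraticExtension F E] (c : E ≃ₐ[F] E)
  {δ : E} (hcδ : c δ = -δ) (hδ : δ ≠ 0) {d : F} (hd : δ * δ = algebraMap F E d)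
  (v : HeightOneSpectrum (𝓞 F)) (n : ℕ) {T₀ : Matrix (Fin n) (Fin n) F} (hT₀ : T₀.IsSymm)
  {JD : Matrix (Fin (n + n)) (Fin (n + n)) E} (hJD : JD = (gramD F n T₀).map (algebraMap F E))

include hT₀ hJD in
/-- **THE PAIRING OF AN ADAPTED UNIPOTENT**: for `g` with adapted matrix `[[1, t], [0, 1]]` and ANY mover `E′`,
`x ⬝ᵥ (c_g *ᵥ x) = im (2 · ((σ ∘ b) ⬝ᵥ (𝕋₀ *ᵥ (t *ᵥ b))))` with `b = halfDiff (eD⁻¹ (E′⁻¹ (x, 0)))` the `Δ⁻`-component (`c_g = cOfFix 𝕋 (E′ ι(g) E′⁻¹)`,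
`𝕋₀ = gramS T₀`; ★ `dotProduct_cOfFix_mover_conj_eq_im` is the case `t = τ • 1`). [cite: Kudla1994, §3] [cite: HarrisKudlaSweet1996, §1 (1.11)] [cite: Rangarao1993, Lemma 3.2 (3.8) p. 351] -/
theorem dotProduct_cOfFix_mover_conj_eq_im_herm (g : UnitaryGroup.localPi E c (n + n) JD v) (t : Matrix (Fin n) (Fin n) (LocalRing E v))
    (hg : adapt (matA F E c v n g) = Matrix.fromBlocks 1 t 0 1)
    (E' : LocalSp F (n + n) (gramD F n T₀) v) (x : Fin (n + n) → v.adicCompletion F) :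
    x ⬝ᵥ cOfFix (localGram F (n + n) (gramD F n T₀) v) (E' * iotaD F E c hcδ hδ hd v n hT₀ hJD g * E'⁻¹) *ᵥ x =
      im (quadraticLocalEquiv E v c hcδ hδ).toLinearEquiv.toAddEquiv
        (2 * ((⇑(conjLocal E c v) ∘ halfDiff ((eD F E c hcδ hδ hd v n).symm (toLin F v E'⁻¹ (x, 0)))) ⬝ᵥ
          (gramS F E v n T₀ *ᵥ (t *ᵥ halfDiff ((eD F E c hcδ hδ hd v n).symm (toLin F v E'⁻¹ (x, 0))))))) := by
  set u := (eD F E c hcδ hδ hd v n).symm (toLin F v E'⁻¹ (x, 0)) with hu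
  have hsplit : dblV (halfSum u) + adblV (halfDiff u) = u := dblV_halfSum_add_adblV_halfDiff u
  rw [dotProduct_cOfFix_mover_conj F E c hcδ hδ hd v n hT₀ hJD g E' x, ← hu, matA_mulVec_of_adapt F E c v n g t hg u, map_add,
    isAlt_formD F E c hcδ hδ hd v n u, zero_add]
  have key : formD F E c hcδ hδ hd v n T₀ u (dblV (t *ᵥ halfDiff u)) =
      formD F E c hcδ hδ hd v n T₀ (dblV (halfSum u) + adblV (halfDiff u)) (dblV (t *ᵥ halfDiff u) + adblV 0) := by
    rw [hsplit, adblV_zero, add_zero]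
  rw [key, formD_dblV_adblV F E c hcδ hδ hd v n hT₀ hJD, Matrix.mulVec_zero, dotProduct_zero, zero_add]

include hT₀ hJD in
/-- the same for the named Siegel unipotent `n(t)` (★ `adapt_matA_nElem`). [cite: Kudla1994, §3] [cite: HarrisKudlaSweet1996, §1 (1.11)] -/
theorem dotProduct_cOfFix_mover_conj_nElem_eq_im_herm (t : Matrix (Fin n) (Fin n) (LocalRing E v))
    (ht : (t.map (conjLocal E c v))ᵀ * gramS F E v n T₀ + gramS F E v n T₀ * t = 0)
    (E' : LocalSp F (n + n) (gramD F n T₀) v) (x : Fin (n + n) → v.adicCompletion F) :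
    x ⬝ᵥ cOfFix (localGram F (n + n) (gramD F n T₀) v) (E' * iotaD F E c hcδ hδ hd v n hT₀ hJD (nElem F E c v n hJD t ht) * E'⁻¹) *ᵥ x =
      im (quadraticLocalEquiv E v c hcδ hδ).toLinearEquiv.toAddEquiv
        (2 * ((⇑(conjLocal E c v) ∘ halfDiff ((eD F E c hcδ hδ hd v n).symm (toLin F v E'⁻¹ (x, 0)))) ⬝ᵥ
          (gramS F E v n T₀ *ᵥ (t *ᵥ halfDiff ((eD F E c hcδ hδ hd v n).symm (toLin F v E'⁻¹ (x, 0))))))) :=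
  dotProduct_cOfFix_mover_conj_eq_im_herm F E c hcδ hδ hd v n hT₀ hJD _ t (adapt_matA_nElem F E c v n hJD t ht) E' x

omit [Algebra.IsQuadraticExtension F E] in
/-- **ADDITIVITY IN `t`** of the hermitian pairing `t ↦ 2·(σ b) ⬝ᵥ (𝕋₀ (t b))` (hence of `x ⬝ᵥ c_{n(t)} x`, and `ψ_v(−½ ·)` of it is a CHARACTER in `t` — the `hadd` of ★ (T1)).
[cite: HarrisKudlaSweet1996, §1 (1.11)] -/
theorem herm_pairing_add (S t t' : Matrix (Fin n) (Fin n) (LocalRing E v)) (b : Fin n → LocalRing E v) :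
    2 * ((⇑(conjLocal E c v) ∘ b) ⬝ᵥ (S *ᵥ ((t + t') *ᵥ b))) = 2 * ((⇑(conjLocal E c v) ∘ b) ⬝ᵥ (S *ᵥ (t *ᵥ b))) + 2 * ((⇑(conjLocal E c v) ∘ b) ⬝ᵥ (S *ᵥ (t' *ᵥ b))) := by
  rw [Matrix.add_mulVec, Matrix.mulVec_add, dotProduct_add, mul_add]

end Doubled

/-! ## §2 Kronecker frames: the pairing is the trace against the Gram matrix -/

section Kronecker

variable {R : Type*} [CommRing R] {ι κ ι' : Type*} [Fintype ι] [Fintype κ] [Fintype ι'] [DecidableEq κ] (e : ι × κ ≃ ι')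

omit [Fintype ι'] [DecidableEq κ] in
/-- index bookkeeping: `Σ_{k j l j'} = Σ_{j' k l j}`. [folklore] -/
theorem sum_reorder (g : κ → ι → κ → ι → R) : (∑ k, ∑ j, ∑ l, ∑ j', g k j l j') = ∑ j', ∑ k, ∑ l, ∑ j, g k j l j' := by
  calc (∑ k, ∑ j, ∑ l, ∑ j', g k j l j') = ∑ k, ∑ j, ∑ j', ∑ l, g k j l j' :=
        Finset.sum_congr rfl fun k _ => Finset.sum_congr rfl fun j _ => Finset.sum_comm
    _ = ∑ k, ∑ j', ∑ j, ∑ l, g k j l j' := Finset.sum_congr rfl fun k _ => Finset.sum_comm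
    _ = ∑ j', ∑ k, ∑ j, ∑ l, g k j l j' := Finset.sum_comm
    _ = ∑ j', ∑ k, ∑ l, ∑ j, g k j l j' := Finset.sum_congr rfl fun j' _ => Finset.sum_congr rfl fun k _ => Finset.sum_comm

/-- **`bᴴ (S ⊗ D) ((t ⊗ 1) b) = tr(S · t · G(b))`** with the GRAM MATRIX `G j i = Σ_{k,l} b(e(j,l)) · D k l · σ(b(e(i,k)))`, for any function `σ` (the involution), any `S, t` (the
form of `𝕍` and the unipotent parameter) and any `D` (the form of `V′`): the Siegel-unipotent pairing in a Kronecker frame only sees the `V′`-Gram matrix of the vector.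
[cite: Kudla1994, §3] [cite: Shimura1997, §13.2] -/
theorem dotProduct_reindex_kronecker_mulVec_eq_trace (σ : R → R) (S t : Matrix ι ι R) (D : Matrix κ κ R) (b : ι' → R) :
    (σ ∘ b) ⬝ᵥ (Matrix.reindex e e (S ⊗ₖ D) *ᵥ (Matrix.reindex e e (t ⊗ₖ (1 : Matrix κ κ R)) *ᵥ b)) =
      Matrix.trace (S * t * Matrix.of fun j i => ∑ k, ∑ l, b (e (j, l)) * D k l * σ (b (e (i, k)))) := by
  -- expand everything into sums over `ι × κ`
  have hre : ∀ f : ι' → R, ∑ p, f p = ∑ i, ∑ k, f (e (i, k)) := fun f => by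
    rw [← Equiv.sum_comp e f, Fintype.sum_prod_type]
  simp only [dotProduct, Matrix.mulVec, Function.comp_apply, Matrix.reindex_apply, Matrix.submatrix_apply, Matrix.kroneckerMap_apply,
    Matrix.one_apply, Matrix.trace, Matrix.diag, Matrix.mul_apply, Matrix.of_apply]
  rw [hre]
  simp only [hre, Equiv.symm_apply_apply, mul_ite, mul_one, mul_zero]
  -- kill the Kronecker `1`: `Σ_{l'} (if l = l' then t j j' else 0) * b (e (j', l')) = t j j' * b (e (j', l))`
  simp only [ite_mul, zero_mul, Finset.sum_ite_eq, Finset.mem_univ, if_true]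
  -- both sides are the same finite sum `Σ_{i k j l j'} σ(b_{ik}) S_ij D_kl t_jj' b_{j'l}`
  simp only [Finset.mul_sum, Finset.sum_mul]
  refine Finset.sum_congr rfl fun i _ => ?_
  rw [sum_reorder]
  refine Finset.sum_congr rfl fun j' _ => Finset.sum_congr rfl fun k _ => Finset.sum_congr rfl fun l _ => Finset.sum_congr rfl fun j _ => ?_
  ring

omit [Fintype ι] [Fintype ι'] in
/-- for a DIAGONAL `D = diag dV′` the Gram matrix is `G j i = Σ_k dV′_k · b(e(j,k)) · σ(b(e(i,k))) = h_{V′}(x_j, x_i)`. [cite: Shimura1997, §13.2] -/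
theorem gram_diagonal (σ : R → R) (dV : κ → R) (b : ι' → R) (j i : ι) :
    (∑ k, ∑ l, b (e (j, l)) * Matrix.diagonal dV k l * σ (b (e (i, k)))) = ∑ k, dV k * b (e (j, k)) * σ (b (e (i, k))) := by
  refine Finset.sum_congr rfl fun k _ => ?_
  rw [Finset.sum_eq_single k (fun l _ hl => by rw [Matrix.diagonal_apply_ne _ (Ne.symm hl), mul_zero, zero_mul]) (fun h => absurd (Finset.mem_univ k) h),
    Matrix.diagonal_apply_eq]
  ring

/-- **THE KRONECKER-FRAME PAIRING, diagonal case**: `bᴴ (S ⊗ diag dV′) ((t ⊗ 1) b) = tr(S · t · G)`, `G j i = Σ_k dV′_k b_{jk} σ(b_{ik})`. [cite: Kudla1994, §3] [cite: Shimura1997, §13.2] -/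
theorem dotProduct_reindex_kronecker_diagonal_mulVec_eq_trace (σ : R → R) (S t : Matrix ι ι R) (dV : κ → R) (b : ι' → R) :
    (σ ∘ b) ⬝ᵥ (Matrix.reindex e e (S ⊗ₖ Matrix.diagonal dV) *ᵥ (Matrix.reindex e e (t ⊗ₖ (1 : Matrix κ κ R)) *ᵥ b)) =
      Matrix.trace (S * t * Matrix.of fun j i => ∑ k, dV k * b (e (j, k)) * σ (b (e (i, k)))) := by
  rw [dotProduct_reindex_kronecker_mulVec_eq_trace]
  congr 2
  ext j i
  rw [Matrix.of_apply, Matrix.of_apply, gram_diagonal]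

/-- additivity of the trace pairing in `t` (bookkeeping for ★ (T1)'s `hadd` in the Kronecker frame). [folklore] -/
theorem trace_mul_mul_add (S t t' G : Matrix ι ι R) : Matrix.trace (S * (t + t') * G) = Matrix.trace (S * t * G) + Matrix.trace (S * t' * G) := by
  rw [Matrix.mul_add, Matrix.add_mul, Matrix.trace_add]

/-- the trace pairing against `G` rewritten as `tr((G S) · t)` — the form in which «trivial for all `t` in a box `Λ`» reads «`G S ∈ Λ^⊥`» (trace duality).
[cite: Shimura1997, §13.2] -/
theorem trace_mul_mul_eq_trace_mul (S t G : Matrix ι ι R) : Matrix.trace (S * t * G) = Matrix.trace (G * S * t) := by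
  rw [Matrix.mul_assoc, Matrix.trace_mul_comm, Matrix.mul_assoc, Matrix.trace_mul_comm]

end Kronecker

/-! ## §3 The tensor embedding: the parameter of `n(t) ⊗ 1` and the pairing at the CM datum -/

section TensorAlgebra

variable {R : Type*} [CommRing R] [Invertible (2 : R)] {ι κ ι' : Type*} [Fintype ι] [Fintype κ] [Fintype ι'] [DecidableEq ι] [DecidableEq κ] [DecidableEq ι']
  (e : ι × κ ≃ ι')

omit [Fintype κ] in
/-- **the adapted matrix of `M ⊗ 1` from that of `M`**: if `adapt M = [[1, t], [0, 1]]` then `adapt (reindex eΣ (M ⊗ₖ 1)) = [[1, reindex e (t ⊗ₖ 1)], [0, 1]]`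
(★ F5c-A `blk_reindex_kronecker` + ★ `adapt_eq`). [cite: Kudla1994, §3] -/
theorem adapt_reindex_kronecker_one_of_adapt (M : Matrix (ι ⊕ ι) (ι ⊕ ι) R) (t : Matrix ι ι R) (hM : adapt M = Matrix.fromBlocks 1 t 0 1) :
    adapt (Matrix.reindex ((Equiv.sumProdDistrib ι ι κ).trans (e.sumCongr e)) ((Equiv.sumProdDistrib ι ι κ).trans (e.sumCongr e))
        (M ⊗ₖ (1 : Matrix κ κ R))) =
      Matrix.fromBlocks 1 (Matrix.reindex e e (t ⊗ₖ (1 : Matrix κ κ R))) 0 1 := by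
  obtain ⟨hA, hB, hC, hD⟩ := blk_reindex_kronecker e M (1 : Matrix κ κ R)
  rw [adapt_eq] at hM
  obtain ⟨hA0, hB0, hC0, hD0⟩ := Matrix.fromBlocks_inj.1 hM
  rw [adapt_eq, hA, hB, hC, hD, hA0, hB0, hC0, hD0, Matrix.one_kronecker_one, Matrix.zero_kronecker]
  simp only [Matrix.reindex_apply, Matrix.submatrix_one_equiv, Matrix.submatrix_zero, Pi.zero_apply]

end TensorAlgebra

section CM

variable (L : Type) [Field L] [NumberField L] [IsCMField L]
variable {N M n : ℕ} (e : Fin N × Fin M ≃ Fin n)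
  (dV : Fin N → L) (hdV : ∀ i, IsCMField.complexConj L (dV i) = dV i)
  (dW : Fin M → L) (hdW : ∀ i, IsCMField.complexConj L (dW i) = dW i)
variable {M₂ M' n' : ℕ} (eW : Fin M × Fin M₂ ≃ Fin M') (e' : Fin N × Fin M' ≃ Fin n')
  (dV' : Fin M₂ → L) (hdV' : ∀ k, IsCMField.complexConj L (dV' k) = dV' k)
variable (v : HeightOneSpectrum (𝓞 (Fp L)))

/-- **the Siegel-unipotent parameter of `n(t) ⊗ 1_{V′}` is `reindex epsV (t ⊗ₖ 1)`** (★ F5c-A `matA_tensorEmbLoc` + ★ `adapt_matA_nElem`). [cite: Kudla1994, §3] [cite: HarrisKudlaSweet1996, §1 (1.11)] -/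
theorem adapt_matA_tensorEmbLoc_nElem (t : Matrix (Fin n) (Fin n) (LocalRing L v))
    (ht : (t.map (conjLocal L (IsCMField.complexConj L) v))ᵀ * gramS (Fp L) L v n (gramR L e dV hdV dW hdW) +
      gramS (Fp L) L v n (gramR L e dV hdV dW hdW) * t = 0) :
    adapt (matA (Fp L) L (IsCMField.complexConj L) v n'
        (tensorEmbLoc L e dV hdV dW hdW eW e' dV' hdV' v (nElem (Fp L) L (IsCMField.complexConj L) v n (hermD_eq_map_gramD L e dV hdV dW hdW) t ht))) =
      Matrix.fromBlocks 1 (Matrix.reindex (epsV e eW e') (epsV e eW e') (t ⊗ₖ (1 : Matrix (Fin M₂) (Fin M₂) (LocalRing L v)))) 0 1 := by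
  haveI : Algebra.IsQuadraticExtension (Fp L) L := IsCMField.isQuadraticExtension L
  rw [matA_tensorEmbLoc]
  exact adapt_reindex_kronecker_one_of_adapt (epsV e eW e') _ t
    (adapt_matA_nElem (Fp L) L (IsCMField.complexConj L) v n (hermD_eq_map_gramD L e dV hdV dW hdW) t ht)

/-- **THE PAIRING OF `n(t) ⊗ 1` IS THE TRACE AGAINST THE `V′`-GRAM MATRIX** (§1 at the tensor datum + ★ `gramS_tensor` + §2): for every mover `E′` of the tensor doubled space and every
`x`, `x ⬝ᵥ (c_{n(t)⊗1} *ᵥ x) = im (2 · tr(𝕋₀ · t · G(x)))`, `G(x) j i = Σ_{k,l} b(epsV(j,l)) · (𝕋_{V′})_{kl} · σ(b(epsV(i,k)))`, `b = halfDiff (eD⁻¹ E′⁻¹ (x, 0))`, at EVERY finite place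
(`LocalRing L v = Π_{w∣v} L_w`, no hypothesis on `v`). [cite: Kudla1994, §3] [cite: HarrisKudlaSweet1996, §1 (1.11)] [cite: Shimura1997, §13.2] -/
theorem dotProduct_cOfFix_tensorEmbLoc_nElem_eq_im_trace (t : Matrix (Fin n) (Fin n) (LocalRing L v))
    (ht : (t.map (conjLocal L (IsCMField.complexConj L) v))ᵀ * gramS (Fp L) L v n (gramR L e dV hdV dW hdW) +
      gramS (Fp L) L v n (gramR L e dV hdV dW hdW) * t = 0)
    (E' : LocalSp (Fp L) (n' + n') (gramD (Fp L) n' (gramR L e' dV hdV (tensorFrame L dW eW dV') (tensorFrame_real L dW hdW eW dV' hdV'))) v)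
    (x : Fin (n' + n') → v.adicCompletion (Fp L)) :
    x ⬝ᵥ cOfFix (localGram (Fp L) (n' + n') (gramD (Fp L) n' (gramR L e' dV hdV (tensorFrame L dW eW dV') (tensorFrame_real L dW hdW eW dV' hdV'))) v)
        (E' * iotaD (Fp L) L (IsCMField.complexConj L) (complexConj_imagUnit L) (imagUnit_ne_zero L) (imagUnit_mul_self L) v n'
          (gramR_isSymm L e' dV hdV (tensorFrame L dW eW dV') (tensorFrame_real L dW hdW eW dV' hdV'))
          (hermD_eq_map_gramD L e' dV hdV (tensorFrame L dW eW dV') (tensorFrame_real L dW hdW eW dV' hdV'))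
          (tensorEmbLoc L e dV hdV dW hdW eW e' dV' hdV' v (nElem (Fp L) L (IsCMField.complexConj L) v n (hermD_eq_map_gramD L e dV hdV dW hdW) t ht)) *
          E'⁻¹) *ᵥ x =
      im (quadraticLocalEquiv L v (IsCMField.complexConj L) (complexConj_imagUnit L) (imagUnit_ne_zero L)).toLinearEquiv.toAddEquiv
        (2 * Matrix.trace (gramS (Fp L) L v n (gramR L e dV hdV dW hdW) * t *
          Matrix.of fun j i => ∑ k, ∑ l,
            halfDiff ((eD (Fp L) L (IsCMField.complexConj L) (complexConj_imagUnit L) (imagUnit_ne_zero L) (imagUnit_mul_self L) v n').symm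
                (toLin (Fp L) v E'⁻¹ (x, 0))) (epsV e eW e' (j, l)) *
              gramS (Fp L) L v M₂ (realDiagonal L dV' hdV') k l *
              conjLocal L (IsCMField.complexConj L) v
                (halfDiff ((eD (Fp L) L (IsCMField.complexConj L) (complexConj_imagUnit L) (imagUnit_ne_zero L) (imagUnit_mul_self L) v n').symm
                  (toLin (Fp L) v E'⁻¹ (x, 0))) (epsV e eW e' (i, k))))) := by
  haveI : Algebra.IsQuadraticExtension (Fp L) L := IsCMField.isQuadraticExtension L
  rw [dotProduct_cOfFix_mover_conj_eq_im_herm (Fp L) L (IsCMField.complexConj L) (complexConj_imagUnit L) (imagUnit_ne_zero L) (imagUnit_mul_self L) v n'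
      (gramR_isSymm L e' dV hdV (tensorFrame L dW eW dV') (tensorFrame_real L dW hdW eW dV' hdV'))
      (hermD_eq_map_gramD L e' dV hdV (tensorFrame L dW eW dV') (tensorFrame_real L dW hdW eW dV' hdV')) _ _
      (adapt_matA_tensorEmbLoc_nElem L e dV hdV dW hdW eW e' dV' hdV' v t ht) E' x,
    gramS_tensor L e dV hdV dW hdW eW e' dV' hdV' v, dotProduct_reindex_kronecker_mulVec_eq_trace]

end CM

end Summit.HodgeConjecture.HodgeConjecture.Cruxes.HLiu418.K2LiuSiegelUnipotentPairingGram

end
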